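import Summits.QuantumFields.YangMills.Theorems.BalabanUVNodesK3AxV8Defs
import Summits.QuantumFields.YangMills.Theses.BalabanUVNodes

/-!
# K3ᴬ v8 — THE TWO REGISTERED STUB TEXTS AS NAMED PROPOSITIONS, THE SKELETON's §2 PIN LEMMAS, ITS BY-NAME COMPOSITION ONTO THE ROUTE DECL, AND ITS §4 (R3) GUARD
# ACCEPTANCE LEMMAS — the companion of `Thm/BalabanUVNodesK3AxV8Defs` (mirror of `K3Skeleton13SepCoPHAxV8.lean` b38fad1764a2d455, registered on stmt-QuantumFields-27247)

R134 seat `pub-ymgap-dag-n16-e` (g31; op-5c K3ᴬ supply hand; dag-lead WORDS 645 (3) GO, cross-lane, explicit), `--kind definition --supports stmt-QuantumFields-27247 --as helper`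
(count-neutral; NO `stub_*` theorem is declared here and nothing is registered — the plan keeps the registered skeleton; on any v9 re-cut this mirror is superseded).  Over the Defs mirror, VERBATIM
from the registered kit (source line ranges of b38fad1764a2d455: §2 = :612–:619, §2b = :620–:663, stub texts = :672–:675 ∕ :684–:689, composition = :697–:718, §4 = :724–:777): §2 `n15At_rrOfRecord_of_pinned` · §2b `n22At_rrOfRecord_of_pinned`, `sensitive_rrOfRecord_of_pinned`, `boxwiseConstant_of_pinned_blind`,
`sensitive_rrOfRecord_of_pinned_of_anchor`, `readOutAt_rrOfRecord_of_pinned` (what the node-U3 ∕ N15 pins buy at the bundle of record BY NAME); §3 the two stub TEXTS as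
`def Stub1TextV8 : Prop` ∕ `def Stub2TextV8 : Prop` (the registered `stub_rates13HV` ∕ `stub_expansion13HV` types, byte for byte) and the kit's composition
`SpineGivenEndpointR13SepCoPHV_of` renamed `spineGivenEndpointR13SepCoPHVAx_of_stubTextsV8` (the two texts ⟹ `…Theses.BalabanUVNodes.SpineGivenEndpointR13SepCoPHVAx` BY NAME, one
application per slot tuple of dag-n19-w3's generic composer) + its def-keyed corollary `spineGivenEndpointR13SepCoPHVAx_of_stubTexts`; §4 the kit's R3 acceptance lemmas (junk
readings FAIL the pinned guard by name).  This file imports the route file (for the decl's NAME only; nothing of it is unfolded) — lanes that only need the texts import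
`…K3AxV8Defs`.

HONEST FRAMING.  Two `def : Prop` (texts mirrored from the registered kit) + by-name compositions and kernel bookkeeping; no estimate; NO stub of K3ᴬ v8 is proved or claimed
here (`Stub1TextV8` ∕ `Stub2TextV8` are HYPOTHESES of §3's theorem); nothing of Bałaban asserted or instantiated; K3ᴬ OPEN (v8 0∕2); counts UNMOVED (typed 28∕28 · discharged
8∕27, A 8∕28).  One finite 𝕋⁴ programme at fixed `ε` — NOT continuum ∕ ℝ⁴ ∕ OS ∕ mass gap ∕ Clay.  No `sorry`, `instance`, `notation`; standard axioms.
-/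

set_option autoImplicit false

noncomputable section

namespace Summit.QuantumFields.YangMills.Theorems.K3AxV8StubTexts

open Literature.MathematicalPhysics.QuantumFieldTheory.Balaban1983to89
open Literature.MathematicalPhysics.QuantumFieldTheory.Balaban1983to89.T4Continuum
open T4WeightBudget (RelWeightBound)
open T4IndicatorShell (ShellWeightBound)
open T4ContinuumYM4Torus (ForSmallCouplings)
open Summit.QuantumFields.BalabanUV.T4Continuum.Spine
open YMDAG.UVSplit
open Node00 (Stage13HParams datumOfRecord₁₃CoPHAx U3Letters₁₁ betaOfRecord₁₃Ax)
open Literature.MathematicalPhysics.QuantumFieldTheory.Balaban1983to89.Node00.U3OfKernels (objectsOfRecord₁₃Ax KernelDecayOfRecord₁₃Ax)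
open Literature.MathematicalPhysics.QuantumFieldTheory.Balaban1983to89.T4OutputRate (Window NE9)
open Literature.MathematicalPhysics.QuantumFieldTheory.Balaban1983to89.B12Sec2to5 (betaPrime510)
open YMDAG.N22.AtKernels (n22At_rateCarriersAx_of_kernels_pin_of_ne9)
open YMDAG.N18.U3GuardsAtKernels (sensitiveOnBoxes_rateCarriersAx_of_kernels_pin boxwiseConstant_betaOfRecord₁₃Ax_of_blind_kernels_pin sensitiveOnBoxes_rateCarriersAx_of_kernels_pin_of_remainderNonvanishing betaOfRecord₁₃Ax_eq_anchor_of_blind_kernels_pin)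
open Summit.QuantumFields.YangMills.BalabanUVNodes.N27ReadOutAtU3OfKernels (readOutAt_objectsOfRecord₁₃Ax_coPH)
open Summit.QuantumFields.YangMills.BalabanUVNodes.SpineRatesHolder (RatesHolderAt)
open YMDAG.N14.TowerGuard (Ne1NondegenerateOnAx Ne1NondegenerateOnCmap not_ne1NondegenerateOnCmap_of_isEmpty)
open Summit.QuantumFields.YangMills.BalabanUVNodes.N15.PairedFamilyGuard (KeyedLiveAx KeyedLiveCmap not_keyedLiveCmap_of_isEmpty keyedLiveCmap_of_no_tuple)
open YMDAG.N18.U3Guards (SensitiveOnBoxes BlindOnBoxes BoxwiseConstant not_sensitiveOnBoxes_of_blind blindOnBoxes_of_forall_eq_zero blindOnBoxes_of_couplingBlind)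
open Summit.QuantumFields.YangMills.BalabanUVNodes.N15.GenuineRecord (fullGSizedObjects n15At_fullGSizedObjects_family)
open Summit.QuantumFields.YangMills.BalabanUVNodes.N15.AtKeyedHome (neZero_blockFactor)
open Summit.QuantumFields.YangMills.BalabanUVNodes.N19CoreEdgeFSCComposer (keyedGuarded₁₃CoPH_of_keyedFacesP_fsc)
open YMDAG.N14.TopBorn (Ne1PinnedOfRecordAx Ne1PinnedOfRecordCmap ne1OfRecordAx ne1OfRecordChi ne1NondegenerateOnCmap_of_ne1PinnedOfRecord n14At_rateCarriersCmap_of_pinned)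
open YMDAG.N18.BetaBoxDegeneracy (RemainderNonvanishingOnBoxes)
open Summit.QuantumFields.YangMills.BalabanUVNodes.N15.SizedNonVanishing (ne_fullGSizedObjects_of_kop_zero_family)
open Summit.QuantumFields.YangMills.BalabanUVNodes.N16PinnedLayer13CoPH (N16PinnedLooseAx N16LettersEnd)
open Summit.QuantumFields.YangMills.Theorems.N21ShellSplitOfRecord13CoPH (WidthLetter₁₃CoPHAx DepthLetter₁₃CoPHAx)  -- v8e (v7: parents)
open Summit.QuantumFields.YangMills.Theorems.N21GappedTopPair13CoPH (crGap2₁₃VAx)  -- v8e (v7: parent)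
open Summit.QuantumFields.YangMills.Theorems.K3AxV8Defs
open Node00 (datumOfRecord₁₃SepCoPHAx datumOfRecord₁₃SepCoPHVAx Revision₁₃Ax)

/-! ## §2 (kit §2∕§2b) What the pins buy at the bundle of record BY NAME -/

/-- **(A3-iii) UNDER THE PIN THE N15 CONJUNCT AT THE BUNDLE OF RECORD HOLDS OUTRIGHT** (dag-n15-a's `n15At_fullGSizedObjects_family`, MODEL LEVEL — no datum content). -/
theorem n15At_rrOfRecord_of_pinned (𝔯 : RateReading13AxP) (ksel : RunSel) (hpin : N15PinnedSized 𝔯) (F : T4Family) (θ : Stage13HParams F 2)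
    (hP : θ.Provisos₁₃CoPHAx F 2) (g₀ : ℕ → ℝ) (os : List (ULoop F)) : N15At (rrOfRecord 𝔯 ksel F θ hP g₀ os).ne2 := by
  obtain ⟨b, aS, ν, μ, α, β, c35, p, hb, haS, h⟩ := hpin
  show N15At (ne2OfRecord₁₁ ((𝔯.lit F θ hP g₀ os).ne2 (ksel F θ hP g₀ os)))
  rw [h]
  exact n15At_fullGSizedObjects_family hb haS ν μ α β c35 p F

/-! ## §2b (t-U3) Sanity (kernel, no `sorry`): what the node-U3 pin buys BY NAME — the three producer files at the bundle of record -/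

/-- (i) **N22 UNDER THE PIN = KERNEL-CURRENCY NE9** (dag-n22-w3 `n22At_rateCarriers_of_kernels_pin_of_ne9`): at a pinned reading, NE9 of the run-A functional OF RECORD on the window
with the letters' rate and moduli gives the N22 conjunct at the bundle of EVERY run length — so at the selected one. -/
theorem n22At_rrOfRecord_of_pinned (𝔯 : RateReading13AxP) (ksel : RunSel) (ℓ : LetterReading) (hpin : U3PinnedKernels 𝔯 ℓ) (F : T4Family) (θ : Stage13HParams F 2)
    (hP : θ.Provisos₁₃CoPHAx F 2) (g₀ : ℕ → ℝ) (os : List (ULoop F)) (hs : (ℓ F θ).Signs)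
    (h9 : NE9 ((objectsOfRecord₁₃Ax F 2 θ.toStage13Params (ℓ F θ)).EA 0) (Window θ.γ) (ℓ F θ).κ (ℓ F θ).moduli) :
    N22At (rrOfRecord 𝔯 ksel F θ hP g₀ os).u3 :=
  n22At_rateCarriersAx_of_kernels_pin_of_ne9 𝔯 θ hP g₀ os (ℓ F θ) hs (hpin F θ hP g₀ os) h9 _

/-- (ii) **THE DISPLAYED N18 PREDICATE UNDER THE PIN = «β₁₃ OF RECORD IS NOT BOXWISE CONSTANT»** (dag-n18-w2 `sensitiveOnBoxes_rateCarriers_of_kernels_pin`): the `KeyedSensitive`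
conclusion at a tuple follows from the non-degeneracy of the record's β-function on the window (v4: the predicate is no longer a guard conjunct, № 13) … -/
theorem sensitive_rrOfRecord_of_pinned (𝔯 : RateReading13AxP) (ksel : RunSel) (ℓ : LetterReading) (hpin : U3PinnedKernels 𝔯 ℓ) (F : T4Family) (θ : Stage13HParams F 2)
    (hP : θ.Provisos₁₃CoPHAx F 2) (hβ : ¬ BoxwiseConstant θ.γ (betaOfRecord₁₃Ax F 2 θ.toStage13Params)) (g₀ : ℕ → ℝ) (os : List (ULoop F)) :
    SensitiveOnBoxes (rrOfRecord 𝔯 ksel F θ hP g₀ os).u3.EA (rrOfRecord 𝔯 ksel F θ hP g₀ os).u3.γ :=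
  sensitiveOnBoxes_rateCarriersAx_of_kernels_pin 𝔯 ℓ hpin F θ hP hβ g₀ os _

/-- … and conversely a pinned reading BLIND over the boxes at the selected level forces β₁₃ of record boxwise constant there (dag-n18-w2
`boxwiseConstant_betaOfRecord₁₃_of_blind_kernels_pin`) — the guard's failure mode under the pin, tuple by tuple. -/
theorem boxwiseConstant_of_pinned_blind (𝔯 : RateReading13AxP) (ksel : RunSel) (ℓ : LetterReading) (hpin : U3PinnedKernels 𝔯 ℓ) (F : T4Family) (θ : Stage13HParams F 2)
    (hP : θ.Provisos₁₃CoPHAx F 2) (g₀ : ℕ → ℝ) (os : List (ULoop F)) (h : BlindOnBoxes (rrOfRecord 𝔯 ksel F θ hP g₀ os).u3.EA θ.γ) :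
    BoxwiseConstant θ.γ (betaOfRecord₁₃Ax F 2 θ.toStage13Params) :=
  boxwiseConstant_betaOfRecord₁₃Ax_of_blind_kernels_pin 𝔯 ℓ hpin F θ hP g₀ os _ h

/-- (ii′) **… READ THROUGH K2⁷'s ANCHOR, THE PREDICATE = THE MISSING LETTER** (№ 13, dag-n18-w2 p596517 `sensitiveOnBoxes_rateCarriers_of_kernels_pin_of_remainderNonvanishing`):
under the node-U3 pin, a record β ANCHORED at `b` (K2⁷ line 1′'s `ScaleAnchor` currency, `b = θ.cβ • beta0OfJs F κ`) whose (2.13) remainder does NOT vanish identically on the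
window — `RemainderNonvanishingOnBoxes θ.γ β₁₃ b`, two-loop type, bounded from ABOVE only in print ([Balaban1987RG1] p. 264 L25–27), UNPRINTED as a lower bound — passes the
displayed N18 predicate at that tuple, every run length.  v4 asserts this letter NOWHERE. -/
theorem sensitive_rrOfRecord_of_pinned_of_anchor (𝔯 : RateReading13AxP) (ksel : RunSel) (ℓ : LetterReading) (hpin : U3PinnedKernels 𝔯 ℓ) (F : T4Family)
    (θ : Stage13HParams F 2) (hP : θ.Provisos₁₃CoPHAx F 2) {b : ℕ → ℝ}
    (hA : ∀ (k : ℕ) (δ : ℝ), 0 < δ → ∃ γ' : ℝ, 0 < γ' ∧ ∀ p : Fin (k + 1) → ℝ, p ∈ B12Beta.HistBox γ' k → |betaOfRecord₁₃Ax F 2 θ.toStage13Params k p - b k| ≤ δ)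
    (hnv : RemainderNonvanishingOnBoxes θ.γ (betaOfRecord₁₃Ax F 2 θ.toStage13Params) b) (g₀ : ℕ → ℝ) (os : List (ULoop F)) :
    SensitiveOnBoxes (rrOfRecord 𝔯 ksel F θ hP g₀ os).u3.EA (rrOfRecord 𝔯 ksel F θ hP g₀ os).u3.γ :=
  sensitiveOnBoxes_rateCarriersAx_of_kernels_pin_of_remainderNonvanishing 𝔯 ℓ hpin F θ hP hA hnv g₀ os _

/-- (iii) **(D4) UNDER THE PIN REDUCES TO PRINT's (5.10) CLAUSE OF RECORD** (dag-n27-w1 `readOutAt_objectsOfRecord₁₃_coPH`): the β-read-out binders at the bundle of record hold at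
every run length from the letter rows and `KernelDecayOfRecord₁₃Ax F 2 θ 0 1 κ` — (5.10) is NOT discharged here (its tree road has undischarged leaves). -/
theorem readOutAt_rrOfRecord_of_pinned (𝔯 : RateReading13AxP) (ksel : RunSel) (ℓ : LetterReading) (hpin : U3PinnedKernels 𝔯 ℓ) (F : T4Family) (θ : Stage13HParams F 2)
    (hP : θ.Provisos₁₃CoPHAx F 2) (g₀ : ℕ → ℝ) (os : List (ULoop F)) (hs : (ℓ F θ).Signs) (hκ : 0 < (ℓ F θ).κ) (hcr : betaPrime510 4 1 (ℓ F θ).κ ≤ (ℓ F θ).cr)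
    (hdec : KernelDecayOfRecord₁₃Ax F 2 θ.toStage13Params 0 1 (ℓ F θ).κ) :
    ReadOutAt (datumOfRecord₁₃CoPHAx F 2 θ hP) (rrOfRecord 𝔯 ksel F θ hP g₀ os).u3 := by
  show ReadOutAt (datumOfRecord₁₃CoPHAx F 2 θ hP) (u3OfRecord₁₃ θ.toStage13Params (𝔯.lit F θ hP g₀ os).u3 (ksel F θ hP g₀ os))
  rw [hpin F θ hP g₀ os]
  exact readOutAt_objectsOfRecord₁₃Ax_coPH θ hP (ℓ F θ) hs hκ hcr _ hdec

/-! ## §3 The two registered stub TEXTS as named propositions and the kit's composition onto the route decl BY NAME -/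

/-- **THE REGISTERED STUB-1 TEXT** (`K3Skeleton13SepCoPHAxV8.stub_rates13HV`, byte for byte; a HYPOTHESIS wherever it appears below — not proved here). [bookkeeping] -/
def Stub1TextV8 : Prop :=
  ∃ β : ℝ, 2 / 3 < β ∧ β < 1 ∧
    ∃ (𝔯 : RateReading13AxP) (ksel : RunSel) (ℓ : LetterReading) (ℓ₃ : T4Family → Node00.NE3Letters₁₁) (g B : T4Family → ℝ),
      GuardedReadingN16 𝔯 ksel ℓ ℓ₃ g B ∧ KeyedRatesHolderD4V β (rrOfRecord 𝔯 ksel)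

/-- **THE REGISTERED STUB-2 TEXT** (`K3Skeleton13SepCoPHAxV8.stub_expansion13HV`, byte for byte; a HYPOTHESIS — not proved here). [bookkeeping] -/
def Stub2TextV8 : Prop :=
  ∀ β : ℝ, 2 / 3 < β → β < 1 →
    ∀ (𝔯 : RateReading13AxP) (ksel : RunSel) (ℓ : LetterReading) (ℓ₃ : T4Family → Node00.NE3Letters₁₁) (g B : T4Family → ℝ),
      GuardedReadingN16 𝔯 ksel ℓ ℓ₃ g B → KeyedRatesHolderD4V β (rrOfRecord 𝔯 ksel) →
      ∃ (jc : CutReading) (ρ ρ' : WidthLetter₁₃CoPHAx 2) (n₁ n₂ : DepthLetter₁₃CoPHAx 2) (cr : SpineReading), PinnedAtLiveGap2 jc ρ ρ' n₁ n₂ cr ∧ DialRows ρ ρ' n₁ n₂ ∧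
        KeyedRelWeight cr ∧ KeyedShellWeight cr ∧ KeyedExtractionV cr ∧ KeyedCoreEdgeHolderD4V β cr (rrOfRecord 𝔯 ksel)

/-- **THE KIT's COMPOSITION, VERBATIM** (`K3Skeleton13SepCoPHAxV8.SpineGivenEndpointR13SepCoPHV_of`, :697–:718, renamed): the stub-1 TEXT and the stub-2 TEXT (as explicit
hypotheses, byte for byte) ⟹ the route decl `…Theses.BalabanUVNodes.SpineGivenEndpointR13SepCoPHVAx` BY NAME — ONE application per slot tuple of dag-n19-w3's GENERIC composer
`N19CoreEdgeFSCComposer.forall_keyed_hybridNE7Under_of_fscFacesP` at the key `Σ' θ (h : θ.Provisos₁₃SepCoPHAx F 2), Revision₁₃Ax F 2 θ h`, `P := PHolderD4 β`; the pin, the dial rows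
and the N20 ∕ N21 ∕ extraction conjuncts are discarded exactly as the kit discards them.  NO stub is proved here: both texts are HYPOTHESES. [bookkeeping] -/
theorem spineGivenEndpointR13SepCoPHVAx_of_stubTextsV8
    (h₁ : ∃ β : ℝ, 2 / 3 < β ∧ β < 1 ∧
    ∃ (𝔯 : RateReading13AxP) (ksel : RunSel) (ℓ : LetterReading) (ℓ₃ : T4Family → Node00.NE3Letters₁₁) (g B : T4Family → ℝ),
      GuardedReadingN16 𝔯 ksel ℓ ℓ₃ g B ∧ KeyedRatesHolderD4V β (rrOfRecord 𝔯 ksel))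
    (h₂ : ∀ β : ℝ, 2 / 3 < β → β < 1 →
    ∀ (𝔯 : RateReading13AxP) (ksel : RunSel) (ℓ : LetterReading) (ℓ₃ : T4Family → Node00.NE3Letters₁₁) (g B : T4Family → ℝ),
      GuardedReadingN16 𝔯 ksel ℓ ℓ₃ g B → KeyedRatesHolderD4V β (rrOfRecord 𝔯 ksel) →
      ∃ (jc : CutReading) (ρ ρ' : WidthLetter₁₃CoPHAx 2) (n₁ n₂ : DepthLetter₁₃CoPHAx 2) (cr : SpineReading), PinnedAtLiveGap2 jc ρ ρ' n₁ n₂ cr ∧ DialRows ρ ρ' n₁ n₂ ∧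
        KeyedRelWeight cr ∧ KeyedShellWeight cr ∧ KeyedExtractionV cr ∧ KeyedCoreEdgeHolderD4V β cr (rrOfRecord 𝔯 ksel)) :
    (∀ (F : Literature.MathematicalPhysics.QuantumFieldTheory.Balaban1983to89.T4Continuum.T4Family) (θ : Literature.MathematicalPhysics.QuantumFieldTheory.Balaban1983to89.Node00.Stage13HParams F 2) (h : θ.Provisos₁₃SepCoPHAx F 2) (v : Literature.MathematicalPhysics.QuantumFieldTheory.Balaban1983to89.Node00.Revision₁₃Ax F 2 θ h), (θ.ZhUnity F 2 ∧ θ.SlotsNondegenerate₁₃Ax F 2) → θ.Admissible F 2 → Literature.MathematicalPhysics.QuantumFieldTheory.Balaban1983to89.B16.EndStatementBPrinted (Literature.MathematicalPhysics.QuantumFieldTheory.Balaban1983to89.Node00.datumOfRecord₁₃SepCoPHVAx F 2 θ h v).C → Literature.MathematicalPhysics.QuantumFieldTheory.Balaban1983to89.DagBinding.EndpointExistence (Literature.MathematicalPhysics.QuantumFieldTheory.Balaban1983to89.Node00.datumOfRecord₁₃SepCoPHVAx F 2 θ h v).C.toB12 → Literature.MathematicalPhysics.QuantumFieldTheory.Balaban1983to89.T4ApexHybrid.HybridNE7Under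 (Literature.MathematicalPhysics.QuantumFieldTheory.Balaban1983to89.Node00.datumOfRecord₁₃SepCoPHVAx F 2 θ h v) (Literature.MathematicalPhysics.QuantumFieldTheory.Balaban1983to89.DagBinding.EndpointExistence (Literature.MathematicalPhysics.QuantumFieldTheory.Balaban1983to89.Node00.datumOfRecord₁₃SepCoPHVAx F 2 θ h v).C.toB12)) := by
  obtain ⟨β, hβ, hβ', 𝔯, ksel, ℓ, ℓ₃, g, B, hg, hr⟩ := h₁
  obtain ⟨_jc, _ρ, _ρ', _n₁, _n₂, cr, -, -, h20, h21, hx, h19⟩ := h₂ β hβ hβ' 𝔯 ksel ℓ ℓ₃ g B hg hr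
  intro F θ h v hG hθ _ _
  exact Summit.QuantumFields.YangMills.BalabanUVNodes.N19CoreEdgeFSCComposer.forall_keyed_hybridNE7Under_of_fscFacesP (N := 2)
    (Θ := fun F => Σ' (θ : Stage13HParams F 2) (h : θ.Provisos₁₃SepCoPHAx F 2), Revision₁₃Ax F 2 θ h)
    (fun {F} _ => True) (fun {F} k => (k.1.ZhUnity F 2 ∧ k.1.SlotsNondegenerate₁₃Ax F 2) ∧ k.1.Admissible F 2)
    (fun {F} k _ => datumOfRecord₁₃SepCoPHVAx F 2 k.1 k.2.1 k.2.2) (fun {F} k _ g₀ os => cr F k.1 k.2.1.toCore g₀ os)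
    (fun {F} k _ g₀ os => rrOfRecord 𝔯 ksel F k.1 k.2.1.toCore g₀ os) (PHolderD4 β)
    (fun F k _ hA g₀ os => h20 F k.1 k.2.1.toCore hA.1 hA.2 g₀ os) (fun F k _ hA g₀ os => h21 F k.1 k.2.1.toCore hA.1 hA.2 g₀ os)
    (fun F k _ hA => hr F k.1 k.2.1 k.2.2 hA.1 hA.2) (fun F k _ hA => h19 F k.1 k.2.1 k.2.2 hA.1 hA.2) (fun F k _ hA => hx F k.1 k.2.1 k.2.2 hA.1 hA.2)
    F ⟨θ, h, v⟩ trivial ⟨hG, hθ⟩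

/-- **THE TWO TEXTS ⟹ K3ᴬ BY NAME** (def-keyed form of the previous theorem). [bookkeeping] -/
theorem spineGivenEndpointR13SepCoPHVAx_of_stubTexts (h₁ : Stub1TextV8) (h₂ : Stub2TextV8) :
    Summit.QuantumFields.YangMills.Theses.BalabanUVNodes.SpineGivenEndpointR13SepCoPHVAx :=
  spineGivenEndpointR13SepCoPHVAx_of_stubTextsV8 h₁ h₂

/-! ## §4 R3 ACCEPTANCE (v4) — junk readings FAIL the pinned guard BY NAME (kernel, no `sorry`; K0⁷-type inhabitation of the keys as a HYPOTHESIS where a keyed guard is read) -/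

section R3

/-- ONE guarded admissible Stage-13 tuple at `N = 2` exists (the shape of K0⁷ `Record13SepCoPHInhabitedAx` at one family, core provisos). -/
def KeysInhabited : Prop :=
  ∃ (F : T4Family) (θ : Stage13HParams F 2) (_ : θ.Provisos₁₃CoPHAx F 2), (θ.ZhUnity F 2 ∧ θ.SlotsNondegenerate₁₃Ax F 2) ∧ θ.Admissible F 2

/-- R3 (i): a reading whose DRESSED TOWER has an EMPTY index at every tuple (evidence #5's `DressedTower PEmpty`) fails the guard — v4: through the guard the N14 pin RECOVERS. -/
theorem not_guardedReading_of_ne1_isEmpty (hex : KeysInhabited) (𝔯 : RateReading13AxP) (ksel : RunSel) (ℓ : LetterReading)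
    (h : ∀ (F : T4Family) (θ : Stage13HParams F 2) (hP : θ.Provisos₁₃CoPHAx F 2) (g₀ : ℕ → ℝ) (os : List (ULoop F)), IsEmpty (𝔯.ne1 F θ hP g₀ os).P) :
    ¬ GuardedReading 𝔯 ksel ℓ := by
  intro hg
  obtain ⟨F, θ, hP, hU, hθ⟩ := hex
  exact not_ne1NondegenerateOnCmap_of_isEmpty 𝔯 UnityNondegAx θ hP hU hθ (fun _ => 0) [] (h F θ hP _ _) (ne1NondegenerateOn_of_guardedReading hg)

/-- R3 (ii): a reading whose PAIRED FAMILIES are EMPTY at every tuple (evidence #5's empty family) fails the guard. -/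
theorem not_guardedReading_of_ne2_isEmpty (hex : KeysInhabited) (𝔯 : RateReading13AxP) (ksel : RunSel) (ℓ : LetterReading)
    (h : ∀ (F : T4Family) (θ : Stage13HParams F 2) (hP : θ.Provisos₁₃CoPHAx F 2) (g₀ : ℕ → ℝ) (os : List (ULoop F)), IsEmpty (rrOfRecord 𝔯 ksel F θ hP g₀ os).ne2.I) :
    ¬ GuardedReading 𝔯 ksel ℓ := by
  rintro ⟨-, h15, -, -⟩
  exact not_keyedLiveCmap_of_isEmpty (Χ := fun F => Node00.chiβOfRecord₁₃Ax F 2) (rrOfRecord 𝔯 ksel) hex h h15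

/-- R3 (iii) (v4, BY NAME): a reading whose PAIRED-PROPAGATOR objects have ALL OPERATOR KERNELS ZERO at ONE tuple and run length (dag-n15-w2's zero-kernel reading p588191, which
passes `KeyedLive` and `N15At` — no carrier-level guard can exclude it) is OFF the (α-N15) pin and fails the guard (dag-n15-w1 `not_sizedPin_of_kop_zero`): v2∕v3 §4's
missing clause, now a theorem. -/
theorem not_guardedReading_of_kop_zero (𝔯 : RateReading13AxP) (ksel : RunSel) (ℓ : LetterReading) {F : T4Family} {θ : Stage13HParams F 2} {hP : θ.Provisos₁₃CoPHAx F 2}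
    {g₀ : ℕ → ℝ} {os : List (ULoop F)} {k : ℕ} (hz : ∀ i n U lam y, ((((𝔯.lit F θ hP g₀ os).ne2 k).Kop i).e n U lam y) = 0) : ¬ GuardedReading 𝔯 ksel ℓ := by
  rintro ⟨-, -, ⟨b, aS, ν, μ, α, β, c35, p, hb, -, hpin⟩, -⟩
  exact ne_fullGSizedObjects_of_kop_zero_family F hb aS ν μ α β c35 p _ hz (hpin F θ hP g₀ os k)  -- v8e: dag-n15-w1's family lemma BY NAME (its reading-level corollary `not_sizedPin_of_kop_zero` binds the parent reading type)

/-- R3 (iv) (v4, replaces v3's (iii)∕(iv) which read the dropped N18 guard): under v4's guard a selected level functional BLIND over the record's boxes at one tuple (evidence #5's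
zero ∕ coupling-blind functionals are blind) is NO LONGER a junk reading that a guard throws out — the node-U3 objects ARE the record's, so blindness FORCES THE RECORD: given K2⁷'s
anchor at `b`, `β₁₃ k v = b k` for every box history `v ∈ ]0, θ.γ]^{k+1}` and every `k` (dag-n18-w2 `betaOfRecord₁₃_eq_anchor_of_blind_kernels_pin`) — the (2.13) remainder's
second moment vanishes identically on the window.  The located content of № 13, asserted nowhere; deciding it either way is not owed by K3⁷. -/
theorem betaOfRecord_eq_anchor_of_guardedReading_of_blind (𝔯 : RateReading13AxP) (ksel : RunSel) (ℓ : LetterReading) (hg : GuardedReading 𝔯 ksel ℓ) {F : T4Family}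
    (θ : Stage13HParams F 2) (hP : θ.Provisos₁₃CoPHAx F 2) {b : ℕ → ℝ}
    (hA : ∀ (k : ℕ) (δ : ℝ), 0 < δ → ∃ γ' : ℝ, 0 < γ' ∧ ∀ p : Fin (k + 1) → ℝ, p ∈ B12Beta.HistBox γ' k → |betaOfRecord₁₃Ax F 2 θ.toStage13Params k p - b k| ≤ δ)
    (g₀ : ℕ → ℝ) (os : List (ULoop F)) (h : BlindOnBoxes (rrOfRecord 𝔯 ksel F θ hP g₀ os).u3.EA θ.γ) (k' : ℕ) (v : Fin (k' + 1) → ℝ) (hv : v ∈ FlowStep.Box θ.γ k') :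
    betaOfRecord₁₃Ax F 2 θ.toStage13Params k' v = b k' :=
  betaOfRecord₁₃Ax_eq_anchor_of_blind_kernels_pin 𝔯 ℓ hg.2.2.2 F θ hP hA g₀ os _ h k' v hv

/-- HONESTY: with NO guarded admissible tuple (¬ K0⁷-shape at `N = 2`) the N15 guard (and the displayed N18 predicate) hold for EVERY reading — a keyed guard is worth exactly K0;
the three PINS, by contrast, bite at every tuple with core provisos. -/
theorem keyedLive_and_keyedSensitive_of_no_tuple (𝔯 : RateReading13AxP) (ksel : RunSel)
    (hno : ∀ (F : T4Family) (θ : Stage13HParams F 2), θ.Provisos₁₃CoPHAx F 2 → (θ.ZhUnity F 2 ∧ θ.SlotsNondegenerate₁₃Ax F 2) → ¬ θ.Admissible F 2) :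
    KeyedLiveAx (rrOfRecord 𝔯 ksel) ∧ KeyedSensitive 𝔯 ksel :=
  ⟨keyedLiveCmap_of_no_tuple (Χ := fun F => Node00.chiβOfRecord₁₃Ax F 2) (rrOfRecord 𝔯 ksel) hno, fun F θ hP hU hθ _ _ => absurd hθ (hno F θ hP hU)⟩

/-- v5: a reading failing the v4 guard fails the N16-pinned guard (every junk reading of §4 stays refused BY NAME). -/
theorem not_guardedReadingN16_of_not_guardedReading {𝔯 : RateReading13AxP} {ksel : RunSel} {ℓ : LetterReading} (h : ¬ GuardedReading 𝔯 ksel ℓ)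
    (ℓ₃ : T4Family → Node00.NE3Letters₁₁) (g B : T4Family → ℝ) : ¬ GuardedReadingN16 𝔯 ksel ℓ ℓ₃ g B := fun h' => h h'.1

end R3

end Summit.QuantumFields.YangMills.Theorems.K3AxV8StubTexts

end
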